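import Mathlib
import HarnessLib
import Literature.NumberTheory.Automorphic.GLnAdelicStructureProofs
import Literature.FieldTheory.Galois.SolvableCompositum
import Summits.Langlands.Langlands.Theses.ExteriorSquareAscent
import Summits.Langlands.Langlands.Theorems.ExteriorSquareAscentSelfTwistedIrreducibleDefs
import Summits.Langlands.Langlands.Theorems.ExteriorSquareAscentSelfTwistedIrreducibleStubAutomorphicInduction
import Summits.Langlands.Langlands.Theorems.ExteriorSquareAscentSelfTwistedIrreducibleStubDescent
import Summits.Langlands.Langlands.Theorems.ExteriorSquareAscentSelfTwistedIrreducibleStubCliffordDichotomy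
import Summits.Langlands.Langlands.Theorems.ExteriorSquareAscentSelfTwistedIrreducibleStubNoFourCharacters
import Summits.Langlands.Langlands.Theorems.ExteriorSquareAscentSelfTwistedIrreducibleStubDoubledDetIsHecke
import Summits.Langlands.Langlands.Theorems.ExteriorSquareAscentSelfTwistedIrreducibleStubPinnedDoublingKill

/-!
# Crux `SelfTwistedIrreducible` (stmt-Langlands-18055) of route `ExteriorSquareAscent`, CONDITIONALLY
# on the tree's named facts — line `Sketch` (idea det-pinning) assembled

`Summit.Langlands.Langlands.Theses.ExteriorSquareAscent.SelfTwistedIrreducible`: for every number field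
`K`, every cuspidal C-algebraic `π` on `GL₄(𝔸_K)` with a Hecke field that is self-twisted by the quadratic
sign of some quadratic `L/K` at almost every place, every `ℓ, ι` and every SEMISIMPLE
`ρ : Γ_K → GL₄(ℚ̄_ℓ)` Satake–Frobenius compatible with `(π, ι)` a.e. is irreducible — Shavali 2026
(arXiv:2603.19768) Cor. 4.6 redone WITHOUT Galois representations over the quadratic field.

This file composes the six LANDED stubs of the registered skeleton `Cruxes/SelfTwistedIrreducible/Lines/
Sketch.lean` (all in namespace `…Cruxes.SelfTwistedIrreducible.DetPinning`):
`stub_automorphicInduction` (`π = AI_{L/K}(f)`, `f` cuspidal on `GL₂/L` not Galois-stable — from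
Arthur–Clozel Thm 4.2(b), multiplicity one and Jacquet–Shalika (2.2)/(2.3) in the `L²` model, taken as
HYPOTHESES), `stub_descent` (`ρ|_{Γ_L}` semisimple, `E`-rational, compatible with `f ⊞ f^τ`),
`stub_cliffordDichotomy` (reducible `ρ` ⇒ `ρ|_{Γ_L}` four characters or doubled; Chebotarev +
Brauer–Nesbitt + Clifford), `stub_noFourCharacters` (Böckle–Hui + isobaric rigidity — from Jacquet–Shalika
(2.2)/(2.3) for Borel–Jacquet data, taken as HYPOTHESES), `stub_doubledDetIsHecke` (rank-one Böckle–Hui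
pins the doubling by a Hecke character), `stub_pinnedDoublingKill` (Hecke non-vanishing vs Rankin–Selberg
positivity forces Galois-stability — contradiction).

THE RESULT IS CONDITIONAL (D-0014 named facts; the gate records `proof.conditional`): its trust base is
exactly the unproved Literature facts
`ArthurClozel1989_inducedLift_of_twist_eq` (Arthur–Clozel Ch. 3 Thm 4.2 (b)), `multiplicity_one_gl`,
`JacquetShalika1981_partialPairL_at_one_of_ne_conj`, `JacquetShalika1981_partialPairL_pole_of_eq_conj`
(Jacquet–Shalika (2.2)/(2.3), `L²` model; (2.3) is proved in tree in ranks `≤ 2`),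
`JacquetShalika1981_partialPairL_boundary_repData`, `JacquetShalika1981_partialPairL_pole_repData`
(the same two facts for Borel–Jacquet data; they are also this route's items `PairLBoundaryJS` /
`PairLPoleJS`, stmt-Langlands-13622 / 19093). Nothing else: Böckle–Hui Thm 1.1, Chebotarev, the
Satake/Frobenius dictionaries, Hecke `L(1, ν) ≠ 0` and the rank-2 Rankin–Selberg pole are theorems of
the tree.
-/

set_option linter.dupNamespace false -- `Summit.Langlands.Langlands` is the mandated namespace

noncomputable section

namespace Summit.Langlands.Langlands.Theorems

open scoped NumberField Polynomial Classical
open Filter Polynomial NumberField IsDedekindDomain Field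
open Literature.NumberTheory.GaloisRepresentations Literature.NumberTheory.Automorphic
open Summit.Langlands.Langlands.Cruxes.SelfTwistedIrreducible.DetPinning

/-- A degree-two extension of number fields has a non-trivial automorphism. [folklore] -/
theorem selfTwistedIrreducible_exists_algEquiv_ne_one (K L : Type) [Field K] [NumberField K] [Field L]
    [NumberField L] [Algebra K L] (h2 : Module.finrank K L = 2) : ∃ τ : L ≃ₐ[K] L, τ ≠ 1 := by
  haveI : FiniteDimensional K L := Module.finite_of_finrank_pos (by rw [h2]; exact two_pos)
  haveI : Algebra.IsSeparable K L := Algebra.IsSeparable.of_integral K L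
  haveI : IsGalois K L := Literature.FieldTheory.Galois.isGalois_of_finrank_eq_two (F := K) h2
  have hcard : Nat.card (L ≃ₐ[K] L) = 2 := by rw [IsGalois.card_aut_eq_finrank, h2]
  by_contra h
  push Not at h
  haveI : Subsingleton (L ≃ₐ[K] L) := ⟨fun a b => by rw [h a, h b]⟩
  have : Nat.card (L ≃ₐ[K] L) ≤ 1 := Finite.card_le_one_iff_subsingleton.mpr inferInstance
  omega

/-- **Crux `SelfTwistedIrreducible` from the tree's named facts (CONDITIONAL result).** The hypotheses
are, by name: Arthur–Clozel Ch. 3 Thm 4.2 (b) (`ArthurClozel1989_inducedLift_of_twist_eq`), multiplicity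
one for `GL_n` (`multiplicity_one_gl`), Jacquet–Shalika (2.2) at `s = 1` and (2.3) in the `L²` model
(`JacquetShalika1981_partialPairL_at_one_of_ne_conj`, `…_pole_of_eq_conj`), and the same two facts for
Borel–Jacquet data (`JacquetShalika1981_partialPairL_boundary_repData`, `…_pole_repData`). The proof is
the composition `SelfTwistedIrreducible_of` of the registered skeleton with its six landed stubs. -/
theorem SelfTwistedIrreducible_of_namedFacts
    (hAC : ∀ (n : ℕ) (F E : Type) [Field F] [NumberField F] [Field E] [NumberField E] [Algebra F E],
      ArthurClozel1989_inducedLift_of_twist_eq n F E)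
    (hm1 : ∀ (n : ℕ) (F : Type) [Field F] [NumberField F]
      (μ : MeasureTheory.Measure (AdelicGroupData.gl n F).automorphicQuotient)
      [(AdelicGroupData.gl n F).IsAutomorphicMeasure μ], multiplicity_one_gl n F μ)
    (h22 : ∀ (n : ℕ) (F : Type) [Field F] [NumberField F]
      (μ : MeasureTheory.Measure (AdelicGroupData.gl n F).automorphicQuotient)
      [(AdelicGroupData.gl n F).IsAutomorphicMeasure μ],
      JacquetShalika1981_partialPairL_at_one_of_ne_conj (n := n) (K := F) (μ := μ))
    (h23 : ∀ (n : ℕ) (F : Type) [Field F] [NumberField F]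
      (μ : MeasureTheory.Measure (AdelicGroupData.gl n F).automorphicQuotient)
      [(AdelicGroupData.gl n F).IsAutomorphicMeasure μ],
      JacquetShalika1981_partialPairL_pole_of_eq_conj (n := n) (K := F) (μ := μ))
    (hJSb : JacquetShalika1981_partialPairL_boundary_repData)
    (hJSp : JacquetShalika1981_partialPairL_pole_repData) :
    Summit.Langlands.Langlands.Theses.ExteriorSquareAscent.SelfTwistedIrreducible := by
  intro K _ _ hcpt π _hC hE hST ℓ _ ι ρ hss hcomp
  obtain ⟨L, _, _, _, hdeg, htw⟩ := hST
  have hq : IsQuadSelfTwisted π L := ⟨hdeg, htw⟩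
  obtain ⟨τ, hτ⟩ := selfTwistedIrreducible_exists_algEquiv_ne_one K L hdeg
  obtain ⟨f, hAI, hns⟩ :=
    stub_automorphicInduction hAC hm1 h22 h23 K hcpt π L hq (isCompact_glFiniteIntegralLevel_holds 2 L)
  obtain ⟨hssL, hrat, hcompL⟩ := stub_descent K L τ hτ hdeg hcpt π _ f hAI hE ℓ ι ρ hss hcomp
  by_contra hirr
  rcases stub_cliffordDichotomy K hcpt π L hq ℓ ι ρ hss hcomp hirr with h4 | hdbl
  · exact stub_noFourCharacters hJSb hJSp K L τ hτ hdeg _ f ℓ ι (ρ.restrictField L) hssL hrat hcompL h4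
  · obtain ⟨χ, hχ⟩ := stub_doubledDetIsHecke K L τ hτ hdeg _ f ℓ ι (ρ.restrictField L) hrat hcompL hdbl
    exact hns (stub_pinnedDoublingKill K L τ hτ hdeg _ f χ hχ)

/-- **The same, with the two Borel–Jacquet Jacquet–Shalika inputs taken as THIS ROUTE'S ITEMS**
`PairLBoundaryJS` (stmt-Langlands-13622) and `PairLPoleJS` (stmt-Langlands-19093), whose texts are the
named facts `JacquetShalika1981_partialPairL_boundary_repData` / `…_pole_repData` with `partialPairL` and
`SatakeFamily` unfolded (definitionally equal). Trust base: Arthur–Clozel Thm 4.2 (b), multiplicity one,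
Jacquet–Shalika (2.2)/(2.3) in the `L²` model, plus the two route items. -/
theorem SelfTwistedIrreducible_of_routeJS
    (hAC : ∀ (n : ℕ) (F E : Type) [Field F] [NumberField F] [Field E] [NumberField E] [Algebra F E],
      ArthurClozel1989_inducedLift_of_twist_eq n F E)
    (hm1 : ∀ (n : ℕ) (F : Type) [Field F] [NumberField F]
      (μ : MeasureTheory.Measure (AdelicGroupData.gl n F).automorphicQuotient)
      [(AdelicGroupData.gl n F).IsAutomorphicMeasure μ], multiplicity_one_gl n F μ)
    (h22 : ∀ (n : ℕ) (F : Type) [Field F] [NumberField F]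
      (μ : MeasureTheory.Measure (AdelicGroupData.gl n F).automorphicQuotient)
      [(AdelicGroupData.gl n F).IsAutomorphicMeasure μ],
      JacquetShalika1981_partialPairL_at_one_of_ne_conj (n := n) (K := F) (μ := μ))
    (h23 : ∀ (n : ℕ) (F : Type) [Field F] [NumberField F]
      (μ : MeasureTheory.Measure (AdelicGroupData.gl n F).automorphicQuotient)
      [(AdelicGroupData.gl n F).IsAutomorphicMeasure μ],
      JacquetShalika1981_partialPairL_pole_of_eq_conj (n := n) (K := F) (μ := μ))
    (h7 : Summit.Langlands.Langlands.Theses.ExteriorSquareAscent.PairLBoundaryJS)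
    (h6 : Summit.Langlands.Langlands.Theses.ExteriorSquareAscent.PairLPoleJS) :
    Summit.Langlands.Langlands.Theses.ExteriorSquareAscent.SelfTwistedIrreducible :=
  SelfTwistedIrreducible_of_namedFacts hAC hm1 h22 h23 (fun n m F _ _ hF hF' hn hm π π' =>
    h7 n m F hF hF' hn hm π π') (fun n F _ _ hF hn π π' => h6 n F hF hn π π')

end Summit.Langlands.Langlands.Theorems

end
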